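import Mathlib
import HarnessLib
import Literature.MathematicalPhysics.StatisticalMechanics.LennardJonesClusters
import Summits.AtomisticToContinuum.Crystallization.Theorems.ContactSaturationLadderHaloCount
import Literature.Geometry.DiscreteGeometry.TwoShellPatterns

/-!
# ContactSaturationLadderHaloChart — floors by grade, the halo law, and the affine two-shell chart for crux `LooseTextureRung` (helper, supports item 30303; part 2 of 2)

Part 2 of the helper authorised by the cell critic (`decomp-a2c-crit-1`, CRITIC-LEDGER rows 198 (iii) and 208: «PRE-CLEARED FOR LANDING as a
helper»); part 1 is `ContactSaturationLadderHaloCount` (vocabulary `UniformlyTight/looseSet/deepSet/voidAdjSet/intEnergy`, species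
`coredSet/corelessSet`, the GS-free count `card_cored6_le`), opened below.  Route `ContactSaturationLadder`, crux `LooseTextureRung`
(stmt-AtomisticToContinuum-30303, DECLARED RESIDUAL-CORE); registered line «DialFreeSieve» v5 untouched; nothing here is a registered item;
every statement is PROVED (0 sorry).

§3 **Floors by grade and the halo law.** The P1 family `ThinClusterFloor r κ C` (grade 0: all injective configurations) and its grade-2
form `ThinClusterFloorGS r κ C` (Lennard-Jones ground states only; WEAKER, `thinClusterFloorGS_of_thinClusterFloor`); the core-free rungs
`CoreFreeRung` / `CoreFreeRungGS` (depth 5).  The HALO LAW `HaloLawGS K C` (H) and its sharp form `CorelessSparsityGS R C` (H♯): e⋆-free,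
energy-free COUNT laws on ground states; PROVED kernels `halo_of_sparsity : R ≤ 6 → CorelessSparsityGS R C → HaloLawGS 4914 (500 + C)`,
`thinClusterFloorGS5_of_halo` (H ⟹ the depth-5 grade-2 floor at any price), `coreFreeRungGS_of_halo`, `coreFreeRungGS_of_sparsity`.
Status of H (critic row 198): labels NEW / INCOMPARABLE / FALSE@grade 0 / TRUE-type@grade 2 endorsed; ADMISSIBLE-HELD as the one declared
mechanism beneath the coreless half of P1 at grade 2; a registered cut through H waits for census T-lens1-halo.

§4 **The affine two-shell chart (sub-line «ElasticChart» v3 = the critic's repair).** `IsAffineTwoShellGood η sLo sHi` (an AFFINE image of the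
fcc/hcp two-shell pattern fits the `3/2`-ball, `η` absolute), WEAKER per site than the tree's similarity chart
(`isAffineTwoShellGood_of_isTwoShellGood`); the non-affine set `nonAffineBarlowSet ρ y p` of a doubled window; K1′_GS `TightNearlyAffineBarlowGS`
(grade 2: on 5-thin doubled windows of a GROUND STATE all but `C₀ρ` particles are affinely good — the grade-0 text K1′ is refuted as typed, critic
row 198 (ii), and is not restated); K2′ `AffineChartedCoreFreeFloor` (grade 0, chart-conditioned elastic floor); the PROVED kernel
`coreFreeRungGS_of_affineChartedGS : K1′_GS → K2′ → CoreFreeRungGS` and `affineChartedCoreFreeFloor_of_coreFreeRung` (K2′ below the grade-0 rung).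
Neither K1′_GS nor K2′ is registered; the sub-line stays HELD under the lineage embargo (λ″).
-/

noncomputable section

open scoped BigOperators Classical
open MeasureTheory Metric
open Literature.MathematicalPhysics.StatisticalMechanics (lennardJones IsGroundState PeriodicConfiguration)
open Summit.AtomisticToContinuum.Crystallization.Theorems.ChargedEnergyGapNegative (eStar)
open Summit.AtomisticToContinuum.Crystallization.Theorems

open Summit.AtomisticToContinuum.Crystallization.Theorems.ContactSaturationLadderHaloCount

namespace Summit.AtomisticToContinuum.Crystallization.Theorems.ContactSaturationLadderHaloChart

variable {N : ℕ}

/-! ## §3 Floors by grade, the core-free rungs, and the halo law -/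

/-- **P1 family · `ThinClusterFloor r κ C`** (grade 0, GS-free; the registered v5 stub `stub_thinClusterFloor8` is
`∃ κ > 0, ∃ C, ThinClusterFloor 8 κ C` up to unfolding): for EVERY finite configuration of DISTINCT points and every ball `B(p,ρ)` (`ρ ≥ 9`)
whose doubled ball holds no `r`-deep loose and no 2-void-adjacent particle, `κ·#{(3/50)-loose in B(p,ρ)} − C·ρ² ≤ 𝓔(y|B(p,ρ)) − #B(p,ρ)·e⋆`.
[XL · TRUE-type · technique class: chart of the tight matrix + elastic coercivity + core surgery for thin defects] -/
def ThinClusterFloor (r κ C : ℝ) : Prop :=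
  ∀ ρ : ℝ, 9 ≤ ρ → ∀ (N : ℕ) (y : Fin N → EuclideanSpace ℝ (Fin 3)) (p : EuclideanSpace ℝ (Fin 3)), Function.Injective y →
    (∀ i : Fin N, dist (y i) p ≤ 2 * ρ → i ∉ deepSet r y) →
      (∀ i : Fin N, dist (y i) p ≤ 2 * ρ → i ∉ voidAdjSet 2 y) →
        κ * (((looseSet (3 / 50) y).filter fun i : Fin N => dist (y i) p ≤ ρ).card : ℝ) - C * ρ ^ 2
          ≤ intEnergy y (Finset.univ.filter fun i : Fin N => dist (y i) p ≤ ρ)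
            - ((Finset.univ.filter fun i : Fin N => dist (y i) p ≤ ρ).card : ℝ) * eStar

/-- **P1 family at grade 2 · `ThinClusterFloorGS r κ C`** [WEAKER than `ThinClusterFloor r κ C`
(`thinClusterFloorGS_of_thinClusterFloor`, one field access) · the only grade at which P1 is CONSUMED toward C]: `ThinClusterFloor r κ C` with
`Function.Injective y` replaced by `IsGroundState lennardJones y`. -/
def ThinClusterFloorGS (r κ C : ℝ) : Prop :=
  ∀ ρ : ℝ, 9 ≤ ρ → ∀ (N : ℕ) (y : Fin N → EuclideanSpace ℝ (Fin 3)) (p : EuclideanSpace ℝ (Fin 3)), IsGroundState lennardJones y →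
    (∀ i : Fin N, dist (y i) p ≤ 2 * ρ → i ∉ deepSet r y) →
      (∀ i : Fin N, dist (y i) p ≤ 2 * ρ → i ∉ voidAdjSet 2 y) →
        κ * (((looseSet (3 / 50) y).filter fun i : Fin N => dist (y i) p ≤ ρ).card : ℝ) - C * ρ ^ 2
          ≤ intEnergy y (Finset.univ.filter fun i : Fin N => dist (y i) p ≤ ρ)
            - ((Finset.univ.filter fun i : Fin N => dist (y i) p ≤ ρ).card : ℝ) * eStar

/-- **WEAKER (kernel)**: P1 ⟹ P1 at grade 2 (one field access). -/
theorem thinClusterFloorGS_of_thinClusterFloor {r κ C : ℝ} (h : ThinClusterFloor r κ C) : ThinClusterFloorGS r κ C :=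
  fun ρ hρ N y p hy hd hv => h ρ hρ N y p hy.1 hd hv

/-- The grade-2 floors are monotone in the depth exactly as the grade-0 ones (`thinClusterFloor_anti`). -/
theorem thinClusterFloorGS_anti {r R κ C : ℝ} (h : r ≤ R) (hT : ThinClusterFloorGS R κ C) : ThinClusterFloorGS r κ C :=
  fun ρ hρ N y p hy hd hv => hT ρ hρ N y p hy (fun i hi hiR => hd i hi (deepSet_anti h y hiR)) hv

/-- **The CORE-FREE RUNG of P1 (depth 5, grade 0)** `CoreFreeRung := ∃ κ > 0, ∃ C, ThinClusterFloor 5 κ C`: on 5-thin (every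
(3/50)-loose particle of the doubled ball has a tight centre within 5), 2-void-free doubled windows of ANY injective configuration the loose
particles of the inner ball pay `κ` each up to `C·ρ²`.  [below P1 (depth 8) by `deepSet_anti` · XL (elastic: Cauchy–Born + coercivity + strain
witness ÷ brush count) · NON-VACUOUS: under-coordinated particles and short pairs are 5-deep, so its world is pure SCALE SPREAD of
twelve-coordinated matter — uniaxially breathing hcp near threshold is up to 90 % (3/50)-loose with ZERO 5-deep particles (lens-1 g18 data),
whereas a vacancy's twelve neighbours are 5-deep (cored)] -/
def CoreFreeRung : Prop := ∃ κ : ℝ, 0 < κ ∧ ∃ C : ℝ, ThinClusterFloor 5 κ C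

/-- **The grade-2 CORE-FREE RUNG** `CoreFreeRungGS := ∃ κ > 0, ∃ C, ThinClusterFloorGS 5 κ C` [WEAKER than the grade-0 rung
`CoreFreeRung` (`coreFreeRungGS_of_coreFreeRung`) · FREE given the halo law H (`coreFreeRungGS_of_halo`)]. -/
def CoreFreeRungGS : Prop := ∃ κ : ℝ, 0 < κ ∧ ∃ C : ℝ, ThinClusterFloorGS 5 κ C

/-- The grade-2 core-free rung is WEAKER than the grade-0 one. -/
theorem coreFreeRungGS_of_coreFreeRung (h : CoreFreeRung) : CoreFreeRungGS := by
  obtain ⟨κ, hκ, C, hT⟩ := h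
  exact ⟨κ, hκ, C, thinClusterFloorGS_of_thinClusterFloor hT⟩

/-- **H · `HaloLawGS K C`** — the HALO LAW on Lennard-Jones GROUND STATES [grade 2 · e⋆-FREE and ENERGY-FREE conclusion · critic
row 198: NEW (no count law of this shape in tree or corpus) · INCOMPARABLE with P1 · FALSE at grade 0 (breathing hcp) · TRUE-type at grade 2 ·
INSTRUMENTABLE (census T-lens1-halo)]: on 8-thin, 2-void-free doubled windows (`ρ ≥ 9`) of a ground state, the (3/50)-loose particles of the
inner ball number at most `K` per 5-deep particle of the inner ball plus `C·ρ²`.  Mechanism expected: interior regularity of force-balanced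
tight matter (no scale gradient away from cores) + a cap on uncored disclination content per window. -/
def HaloLawGS (K C : ℝ) : Prop :=
  ∀ ρ : ℝ, 9 ≤ ρ → ∀ (N : ℕ) (y : Fin N → EuclideanSpace ℝ (Fin 3)) (p : EuclideanSpace ℝ (Fin 3)), IsGroundState lennardJones y →
    (∀ i : Fin N, dist (y i) p ≤ 2 * ρ → i ∉ deepSet 8 y) →
      (∀ i : Fin N, dist (y i) p ≤ 2 * ρ → i ∉ voidAdjSet 2 y) →
        (((looseSet (3 / 50) y).filter fun i : Fin N => dist (y i) p ≤ ρ).card : ℝ)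
          ≤ K * (((deepSet 5 y).filter fun i : Fin N => dist (y i) p ≤ ρ).card : ℝ) + C * ρ ^ 2

/-- **H♯ · `CorelessSparsityGS R C`** [sharp form of H at brush radius `R` · e⋆-free · monotone in `R` (`corelessSparsityGS_mono`) ·
TRUE-type for `R` beyond the equilibrium halo width]: on 8-thin, 2-void-free doubled windows of a ground state, the loose particles farther
than `R` from every 5-deep particle number at most `C·ρ²`. -/
def CorelessSparsityGS (R C : ℝ) : Prop :=
  ∀ ρ : ℝ, 9 ≤ ρ → ∀ (N : ℕ) (y : Fin N → EuclideanSpace ℝ (Fin 3)) (p : EuclideanSpace ℝ (Fin 3)), IsGroundState lennardJones y →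
    (∀ i : Fin N, dist (y i) p ≤ 2 * ρ → i ∉ deepSet 8 y) →
      (∀ i : Fin N, dist (y i) p ≤ 2 * ρ → i ∉ voidAdjSet 2 y) →
        (((corelessSet R y).filter fun i : Fin N => dist (y i) p ≤ ρ).card : ℝ) ≤ C * ρ ^ 2

/-- Coreless sparsity is monotone in the brush radius (fewer coreless particles) and in the constant. -/
theorem corelessSparsityGS_mono {R R' C C' : ℝ} (hR : R ≤ R') (hC : C ≤ C') (h : CorelessSparsityGS R C) : CorelessSparsityGS R' C' := by
  intro ρ hρ N y p hy hd hv
  have h1 := h ρ hρ N y p hy hd hv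
  have h2 : (((corelessSet R' y).filter fun i : Fin N => dist (y i) p ≤ ρ).card : ℝ)
      ≤ (((corelessSet R y).filter fun i : Fin N => dist (y i) p ≤ ρ).card : ℝ) := by
    exact_mod_cast Finset.card_le_card (Finset.filter_subset_filter _ (corelessSet_anti hR y))
  have h3 : C * ρ ^ 2 ≤ C' * ρ ^ 2 := mul_le_mul_of_nonneg_right hC (sq_nonneg ρ)
  linarith

/-- **H♯ ⟹ H (PROVED for brush radii `R ≤ 6`)**: `CorelessSparsityGS R C ⟹ HaloLawGS 4914 (500 + C)`. -/
theorem halo_of_sparsity {R C : ℝ} (hR : R ≤ 6) (h : CorelessSparsityGS R C) : HaloLawGS 4914 (500 + C) := by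
  intro ρ hρ N y p hy hd hv
  have h1 := h ρ hρ N y p hy hd hv
  have h2 := card_cored6_le y p hρ
  have hsum := card_cored_add_coreless 6 y (fun i : Fin N => dist (y i) p ≤ ρ)
  have h3 : (((corelessSet 6 y).filter fun i : Fin N => dist (y i) p ≤ ρ).card : ℝ)
      ≤ (((corelessSet R y).filter fun i : Fin N => dist (y i) p ≤ ρ).card : ℝ) := by
    exact_mod_cast Finset.card_le_card (Finset.filter_subset_filter _ (corelessSet_anti hR y))
  rw [← hsum]
  linarith

/-- **H ⟹ the grade-2 depth-5 floor with an ARBITRARY price `κ ≥ 0`** (on 5-thin windows the right-hand count of H vanishes, so H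
bounds the loose count by `C'ρ²`, and the order-0 floor `intEnergy_floor` pays for the rest). -/
theorem thinClusterFloorGS5_of_halo {K C' : ℝ} (hH : HaloLawGS K C') {κ : ℝ} (hκ : 0 ≤ κ) : ThinClusterFloorGS 5 κ (κ * C') := by
  intro ρ hρ N y p hy hd5 hv
  have hd8 : ∀ i : Fin N, dist (y i) p ≤ 2 * ρ → i ∉ deepSet 8 y :=
    fun i hi h8 => hd5 i hi (deepSet_anti (by norm_num : (5 : ℝ) ≤ 8) y h8)
  have h1 := hH ρ hρ N y p hy hd8 hv
  have hX : ((deepSet 5 y).filter fun i : Fin N => dist (y i) p ≤ ρ) = ∅ := by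
    refine Finset.filter_eq_empty_iff.2 fun i hi hiρ => hd5 i ?_ hi
    linarith
  rw [hX, Finset.card_empty, Nat.cast_zero, mul_zero, zero_add] at h1
  have h2 := mul_le_mul_of_nonneg_left h1 hκ
  have h3 := intEnergy_floor hy.1 (Finset.univ.filter fun i : Fin N => dist (y i) p ≤ ρ)
  have h4 : κ * (C' * ρ ^ 2) = κ * C' * ρ ^ 2 := by ring
  linarith

/-- **KERNEL (PROVED)**: H ⟹ the grade-2 core-free rung, with price 1. -/
theorem coreFreeRungGS_of_halo {K C' : ℝ} (hH : HaloLawGS K C') : CoreFreeRungGS :=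
  ⟨1, one_pos, 1 * C', thinClusterFloorGS5_of_halo hH zero_le_one⟩

/-- H♯ with brush radius `R ≤ 6` gives the grade-2 core-free rung (via the halo law). -/
theorem coreFreeRungGS_of_sparsity {R C : ℝ} (hR : R ≤ 6) (h : CorelessSparsityGS R C) : CoreFreeRungGS :=
  coreFreeRungGS_of_halo (halo_of_sparsity hR h)

/-! ## §4 The affine two-shell chart: K1′_GS, K2′ and the v3 kernel -/

/-- **`IsAffineTwoShellGood η sLo sHi x i`** — AFFINE two-shell fcc/hcp goodness (cell critic rows 185 (iii) / 190; `η` ABSOLUTE, row 198):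
there are a continuous linear map `F` of `ℝ³` with `sLo·|v| ≤ |F v| ≤ sHi·|v|` for all `v`, a pattern `P ∈ {fccTwoShellPattern, hcpTwoShellPattern}`
(TREE `Literature.Geometry.DiscreteGeometry.TwoShellPatterns`) and an assignment `f` of particles `≠ i` to the pattern points, injective on `P`, with
`|x(f v) − (x i + F v)| ≤ η` for all `v ∈ P`, such that every particle `j ≠ i` in the affine image `x i + F·B̄(0, 3/2)` is assigned.  Homogeneously
strained Barlow matter is exactly good (`η = 0`); icosahedral and five-fold-axis shells are not (no affine image of the cuboctahedron /
anticuboctahedron is an icosahedral shell). -/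
def IsAffineTwoShellGood (η sLo sHi : ℝ) {N : ℕ} (x : Fin N → EuclideanSpace ℝ (Fin 3)) (i : Fin N) : Prop :=
  ∃ (F : EuclideanSpace ℝ (Fin 3) →L[ℝ] EuclideanSpace ℝ (Fin 3)) (P : Finset (EuclideanSpace ℝ (Fin 3)))
    (f : EuclideanSpace ℝ (Fin 3) → Fin N),
    (∀ v : EuclideanSpace ℝ (Fin 3), sLo * ‖v‖ ≤ ‖F v‖ ∧ ‖F v‖ ≤ sHi * ‖v‖) ∧
    (P = Literature.Geometry.DiscreteGeometry.fccTwoShellPattern ∨ P = Literature.Geometry.DiscreteGeometry.hcpTwoShellPattern) ∧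
    (∀ v ∈ P, f v ≠ i ∧ dist (x (f v)) (x i + F v) ≤ η) ∧ Set.InjOn f ↑P ∧
    ∀ j : Fin N, j ≠ i → (∃ u : EuclideanSpace ℝ (Fin 3), ‖u‖ ≤ 3 / 2 ∧ x j = x i + F u) → ∃ v ∈ P, f v = j

/-- **Similarity-good ⟹ affine-good** (pure geometry; the affine chart is WEAKER per site than the TREE similarity chart
`Literature.Geometry.DiscreteGeometry.IsTwoShellGood`, tolerance converted to the absolute scale `ε·aHi`): take `F = a·A`. -/
theorem isAffineTwoShellGood_of_isTwoShellGood {ε aLo aHi : ℝ} (hε : 0 ≤ ε) (haLo : 0 ≤ aLo) {x : Fin N → EuclideanSpace ℝ (Fin 3)}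
    {i : Fin N} (h : Literature.Geometry.DiscreteGeometry.IsTwoShellGood ε aLo aHi x i) : IsAffineTwoShellGood (ε * aHi) aLo aHi x i := by
  obtain ⟨a, haLo', haHi, A, P, f, hP, hf, hinj, hhit⟩ := h
  have ha : 0 ≤ a := haLo.trans haLo'
  have happ : ∀ v : EuclideanSpace ℝ (Fin 3), (a • A.toContinuousLinearMap) v = a • A v := fun v => rfl
  have hn : ∀ v : EuclideanSpace ℝ (Fin 3), ‖(a • A.toContinuousLinearMap) v‖ = a * ‖v‖ := by
    intro v
    rw [happ, norm_smul, Real.norm_of_nonneg ha, LinearIsometry.norm_map]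
  refine ⟨a • A.toContinuousLinearMap, P, f, ?_, hP, ?_, hinj, ?_⟩
  · intro v
    rw [hn]
    exact ⟨mul_le_mul_of_nonneg_right haLo' (norm_nonneg _), mul_le_mul_of_nonneg_right haHi (norm_nonneg _)⟩
  · intro v hv
    refine ⟨(hf v hv).1, ?_⟩
    rw [happ]
    exact (hf v hv).2.trans (mul_le_mul_of_nonneg_left haHi hε)
  · rintro j hj ⟨u, hu, hju⟩
    refine hhit j hj ?_
    rw [hju, dist_eq_norm, add_sub_cancel_left, hn]
    have := mul_le_mul_of_nonneg_left hu ha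
    linarith

/-- The particles of the inner doubled ball `B(p, 2ρ − 2)` that are NOT affinely two-shell Barlow-good at (absolute) tolerance `1/16`, singular
values in `[7/10, 13/10]`. -/
def nonAffineBarlowSet (ρ : ℝ) (y : Fin N → EuclideanSpace ℝ (Fin 3)) (p : EuclideanSpace ℝ (Fin 3)) : Finset (Fin N) :=
  Finset.univ.filter fun i : Fin N => dist (y i) p ≤ 2 * ρ - 2 ∧ ¬ IsAffineTwoShellGood (1 / 16) (7 / 10) (13 / 10) y i

/-- **K2′ · AFFINELY CHARTED CORE-FREE FLOOR** `AffineChartedCoreFreeFloor` [grade 0 · ELASTICITY · XL in class (chart ⟹ Cauchy–Born /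
elastic coercivity with certified constants; partner of the landed AFFINE Cauchy–Born floor `ContactSaturationLadderCauchyBornFloor.cauchyBorn_floor`,
p784184) · WEAKER than the grade-0 rung (`affineChartedCoreFreeFloor_of_coreFreeRung`) · critic row 198: UNAFFECTED by the sheared-B hcp witness
(laminate windows violate its chart-count hypothesis)]: on 5-thin, 2-void-adjacency-free doubled windows of an injective configuration that are
affinely Barlow-good off `C₀·ρ` particles, the (3/50)-loose particles of the inner ball pay `κ` each up to `C·ρ²` (for every `C₀`; `κ, C` may
depend on `C₀`). -/
def AffineChartedCoreFreeFloor : Prop :=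
  ∀ C₀ : ℝ, ∃ κ : ℝ, 0 < κ ∧ ∃ C : ℝ, ∀ ρ : ℝ, 9 ≤ ρ → ∀ (N : ℕ) (y : Fin N → EuclideanSpace ℝ (Fin 3)) (p : EuclideanSpace ℝ (Fin 3)),
    Function.Injective y → (∀ i : Fin N, dist (y i) p ≤ 2 * ρ → i ∉ deepSet 5 y) →
      (∀ i : Fin N, dist (y i) p ≤ 2 * ρ → i ∉ voidAdjSet 2 y) → ((nonAffineBarlowSet ρ y p).card : ℝ) ≤ C₀ * ρ →
        κ * (((looseSet (3 / 50) y).filter fun i : Fin N => dist (y i) p ≤ ρ).card : ℝ) - C * ρ ^ 2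
          ≤ intEnergy y (Finset.univ.filter fun i : Fin N => dist (y i) p ≤ ρ)
            - ((Finset.univ.filter fun i : Fin N => dist (y i) p ≤ ρ).card : ℝ) * eStar

/-- K2′ is WEAKER than the grade-0 core-free rung (the rung gives it outright, ignoring the chart hypothesis). -/
theorem affineChartedCoreFreeFloor_of_coreFreeRung (h : CoreFreeRung) : AffineChartedCoreFreeFloor := by
  intro C₀
  obtain ⟨κ, hκ, C, hT⟩ := h
  exact ⟨κ, hκ, C, fun ρ hρ N y p hy hd5 hv _ => hT ρ hρ N y p hy hd5 hv⟩


/-- **K1′_GS · BOUNDED NON-AFFINE CONTENT ON GROUND STATES** `TightNearlyAffineBarlowGS` [grade 2 · GEOMETRY of force-balanced tight matter ·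
the REPAIR prescribed by the cell critic (CRITIC-LEDGER row 198 (ii)): the grade-0 text K1′ `TightNearlyAffineBarlow` (the same statement over
ALL injective configurations) is REFUTED AS TYPED by the «sheared-B hcp» laminate (every B layer of hcp displaced by `s·ê`, `s ∈ (1/16, ((53/50)²−1)/√3]`,
interlayer spacing re-tuned to keep the minimal distance `1`: every bulk particle is `UniformlyTight (3/50) 1` yet none is affinely two-shell good at
`η = 1/16`) — an optical-shear pattern that is not force-balanced, hence not a ground state; K1′ is therefore NOT restated here · TRUE-type at grade 2
(critic row 198) · census-killable in kind on relaxed specimens (five-fold axes are the expected `O(ρ)` class; census SA 2026-08-30: the centre of an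
IDEAL multi-shell Mackay icosahedron is (3/50)-tight with an icosahedral shell — grade 0 again, relaxed Mackay centres are not)]: on 5-thin doubled
windows (`ρ ≥ 9`) of a Lennard-Jones GROUND STATE, all but `C₀·ρ` particles of `B(p, 2ρ − 2)` are affinely two-shell Barlow-good. -/
def TightNearlyAffineBarlowGS : Prop :=
  ∃ C₀ : ℝ, ∀ ρ : ℝ, 9 ≤ ρ → ∀ (N : ℕ) (y : Fin N → EuclideanSpace ℝ (Fin 3)) (p : EuclideanSpace ℝ (Fin 3)), IsGroundState lennardJones y →
    (∀ i : Fin N, dist (y i) p ≤ 2 * ρ → i ∉ deepSet 5 y) → ((nonAffineBarlowSet ρ y p).card : ℝ) ≤ C₀ * ρ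

/-- **KERNEL of the repaired sub-line «ElasticChart» v3 (PROVED, one field access)**: K1′_GS ∧ K2′ ⟹ the grade-2 core-free rung
`CoreFreeRungGS` — a ground state is injective (`IsGroundState.1`), K1′_GS supplies the chart count that K2′ consumes. -/
theorem coreFreeRungGS_of_affineChartedGS (h1 : TightNearlyAffineBarlowGS) (h2 : AffineChartedCoreFreeFloor) : CoreFreeRungGS := by
  obtain ⟨C₀, hC₀⟩ := h1
  obtain ⟨κ, hκ, C, hK⟩ := h2 C₀
  refine ⟨κ, hκ, C, ?_⟩
  intro ρ hρ N y p hy hd5 hv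
  exact hK ρ hρ N y p hy.1 hd5 hv (hC₀ ρ hρ N y p hy hd5)

end Summit.AtomisticToContinuum.Crystallization.Theorems.ContactSaturationLadderHaloChart
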